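import Mathlib
import HarnessLib
import Literature.NumberTheory.Automorphic.ACCAutomorphyLiftingCrystalline
import Literature.NumberTheory.GaloisRepresentations.DecomposedGenericOfQuadratic
import Literature.NumberTheory.GaloisRepresentations.ChebotarevCosetCyclotomic
import Literature.NumberTheory.GaloisRepresentations.CalegariEvenFontaineMazurTwo
import Literature.NumberTheory.GaloisRepresentations.ResidualGaloisRepOpenKernel
import Literature.RepresentationTheory.Semisimple.IrreducibleOfCharpoly

/-!
# Helpers for stub B (`stub_adjointResidualImage`) of crux `AdjointLiftingGL3`, line `birth`:
# absolute irreducibility transfer, regular semisimple elements of enormous subgroups, and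
# "decomposed generic" over `ℚ` from one regular semisimple element (Chebotarev)

Crux `stmt-Langlands-16779` = `Summit.Langlands.Langlands.Theses.RamifiedCoefficientSeed.AdjointLiftingGL3`
(line `birth`).  General lemmas (no reference to the crux's `ρ`), all PROVED, used by the sibling
file `RamifiedCoefficientSeedAdjointLiftingGL3StubAdjointResidualImage.lean`:

* `isAbsIrreducible_of_charpoly_eq` — absolute irreducibility of `G → GL_n(k)` is detected by
  characteristic polynomials (Brauer–Nesbitt over any field + semisimplification, the tree's
  `Literature.RepresentationTheory.Semisimple.isIrreducible_of_charpoly_eq`, after extension of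
  scalars); `IsAbsIrreducible.of_range_le` — it only depends on the image.
* `exists_isRegularSemisimple_of_isEnormous` — an enormous subgroup `H ≤ GL_n(k)` (ACC+
  Def. 6.2.28, tree `Subgroup.IsEnormous`), `n ≥ 2`, contains a regular semisimple element:
  clause (3) applied to a simple `k[H]`-submodule of `ad⁰ ≠ 0` (exists by Artinianity).
* `isDecomposedGeneric_of_exists_isRegularSemisimple` — for `k` of characteristic `p` and
  `τ : Γ_ℚ → GL_n(k)` with open kernel, ONE `g ∈ Γ_{ℚ(ζ_p)}` with `τ g` regular semisimple makes
  `τ` decomposed generic (ACC+ Def. 4.3.1, tree `IsDecomposedGeneric`): Chebotarev in the tree's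
  proved coset form `infinite_setOf_prime_absNorm_frobenius_mul_inv_mem` (`ChebotarevCosetCyclotomic`,
  from `chebotarev_artinRep_holds`) for `N = ker τ ∩ Γ_{ℚ(ζ_p)}` gives `l ≠ p` with `τ(I_𝔓) = 1`
  above `l` and a Frobenius `Φ ∈ N g`; `Φ ∈ Γ_{ℚ(ζ_p)}` forces `l ≡ 1 (mod p)`
  (`residueCard_modEq_one_of_isArithFrobAt_of_mem`), i.e. `l = 1` in `k̄`; all Frobenii above `l`
  are `τ`-conjugate to `τ g` (transitivity `exists_smul_eq_of_mem_primesAbove_holds`, inertia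
  killed), so eigenvalues are distinct with ratios `≠ 1 = l`; every `l` splits completely in `ℚ`
  (Mathlib `NumberField.not_dvd_discr_iff_isUnramifiedIn`, `discr_rat`).  This is the argument of
  ACC+ Lemma 4.3.2 / Lemma 7.1.3 (3) over `ℚ`.
* `adjointResidualImage_decomposedGeneric` — the same for a residual representation `τ` of a
  `ρ : Γ_ℚ → GL_n(ℚ̄_p)` over `ℤ̄_p/𝔪` (open kernel, `isOpen_ker_of_isResidualRepOf`; `char = p`,
  the tree's `charP_padicAlgClResidueField`): the closed sub-goal registered on the crux item.

## References

* [ACCGHLNSTT2023] P. B. Allen et al., *Potential automorphy over CM fields*, Ann. of Math. (2) 197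
  (2023) (arXiv:1812.09999): Def. 4.3.1, Lemma 4.3.2, Def. 6.2.28, Lemma 7.1.3.
* [DarmonDiamondTaylor1995] H. Darmon, F. Diamond, R. Taylor, *Fermat's Last Theorem* (1995), §2.1.
* [TateGCFT1967] J. Tate, *Global class field theory*, in Cassels–Fröhlich (1967), Ch. VII §2.4.
-/

set_option linter.dupNamespace false

noncomputable section

namespace Summit.Langlands.Langlands.Cruxes.AdjointLiftingGL3.Birth

open scoped MatrixGroups NumberField Polynomial
open NumberField IsDedekindDomain Field Filter
open Literature.NumberTheory.GaloisRepresentations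
open Rat.HeightOneSpectrum

universe u v w

/-! ## §1. Absolute irreducibility: transfer along characteristic polynomials and ranges -/

section AbsIrreducible

variable {G : Type u} [Group G] {G' : Type v} [Group G'] {k : Type w} [Field k] {n : ℕ}

/-- **Absolute irreducibility is detected by characteristic polynomials.**  If
`τ, σ : G → GL_n(k)` have the same characteristic polynomials and `σ` is absolutely irreducible,
so is `τ`: after any extension of scalars `f : k → k'` the characteristic polynomials still agree
(`Matrix.charpoly_map`), and irreducibility is detected by them (Brauer–Nesbitt + semisimplification,
the tree's `isIrreducible_of_charpoly_eq`). [cite: DarmonDiamondTaylor1995, §2.1 (Prop. 2.6 (b))] -/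
theorem isAbsIrreducible_of_charpoly_eq {τ σ : G →* GL (Fin n) k}
    (h : ∀ g, ((τ g : GL (Fin n) k) : Matrix (Fin n) (Fin n) k).charpoly =
      ((σ g : GL (Fin n) k) : Matrix (Fin n) (Fin n) k).charpoly)
    (hσ : IsAbsIrreducible σ) : IsAbsIrreducible τ := by
  intro k' _ f
  refine Literature.RepresentationTheory.Semisimple.isIrreducible_of_charpoly_eq
    ((Matrix.GeneralLinearGroup.map f).comp τ) ((Matrix.GeneralLinearGroup.map f).comp σ)
    (fun g => ?_) (hσ k' f)
  change (((τ g : GL (Fin n) k) : Matrix (Fin n) (Fin n) k).map f).charpoly =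
    (((σ g : GL (Fin n) k) : Matrix (Fin n) (Fin n) k).map f).charpoly
  rw [Matrix.charpoly_map, Matrix.charpoly_map, h g]

/-- **Absolute irreducibility only depends on the image**: if `τ : G' → GL_n(k)` is absolutely
irreducible and `τ(G') ⊆ σ(G)`, then `σ` is absolutely irreducible. [folklore] -/
theorem IsAbsIrreducible.of_range_le {τ : G' →* GL (Fin n) k} {σ : G →* GL (Fin n) k}
    (hτ : IsAbsIrreducible τ) (h : τ.range ≤ σ.range) : IsAbsIrreducible σ := by
  intro k' _ f
  refine isIrreducible_glRepresentation_of_range_le (hτ k' f) ?_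
  rw [MonoidHom.range_comp, MonoidHom.range_comp]
  exact Subgroup.map_mono h

end AbsIrreducible

/-! ## §2. An enormous subgroup contains a regular semisimple element -/

section Enormous

variable {k : Type u} [Field k] {n : ℕ}

/-- For `n ≥ 2` the module `ad⁰ ⊂ M_n(k)` of trace-zero matrices is non-zero (it contains the
elementary matrix `E₀₁`). [folklore] -/
theorem nontrivial_adZero (hn : 2 ≤ n) : Nontrivial (adZero (Fin n) k).toSubmodule := by
  set i : Fin n := ⟨0, by omega⟩ with hi
  set j : Fin n := ⟨1, by omega⟩ with hj
  have hij : i ≠ j := by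
    rw [hi, hj, ne_eq, Fin.mk.injEq]
    exact Nat.zero_ne_one
  have hmem : Matrix.single i j (1 : k) ∈ (adZero (Fin n) k).toSubmodule := by
    rw [mem_adZero_toSubmodule_iff, Matrix.trace_single_eq_of_ne i j (1 : k) hij]
  refine ⟨⟨Matrix.single i j (1 : k), hmem⟩, 0, fun h0 => ?_⟩
  have h1 : Matrix.single i j (1 : k) = 0 := congrArg Subtype.val h0
  have h2 := congrFun (congrFun h1 i) j
  rw [Matrix.single_apply_same, Matrix.zero_apply] at h2
  exact one_ne_zero h2

/-- **An enormous subgroup `H ≤ GL_n(k)`, `n ≥ 2`, contains a regular semisimple element**: the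
`k[H]`-module `ad⁰ ≠ 0` is finite-dimensional, hence has a simple submodule `W` (an atom of the
lattice of subrepresentations), and clause (3) of ACC+ Def. 6.2.28 supplies a regular semisimple
`h ∈ H` (with `W^h ≠ 0`). [cite: ACCGHLNSTT2023, Def. 6.2.28 (3)] -/
theorem exists_isRegularSemisimple_of_isEnormous {H : Subgroup (GL (Fin n) k)}
    (hH : Subgroup.IsEnormous H) (hn : 2 ≤ n) :
    ∃ h : GL (Fin n) k, h ∈ H ∧ IsRegularSemisimple h := by
  set R := Subgroup.adZeroRep H with hR
  haveI : Nontrivial (adZero (Fin n) k).toSubmodule := nontrivial_adZero hn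
  haveI : Nontrivial R.asModule := inferInstanceAs (Nontrivial (adZero (Fin n) k).toSubmodule)
  haveI : IsArtinian k R.asModule :=
    inferInstanceAs (IsArtinian k (adZero (Fin n) k).toSubmodule)
  haveI : IsArtinian (MonoidAlgebra k H) R.asModule := isArtinian_of_tower k inferInstance
  obtain ⟨N, hN, -⟩ := (eq_bot_or_exists_atom_le
    (⊤ : Submodule (MonoidAlgebra k H) R.asModule)).resolve_left top_ne_bot
  set e := (Subrepresentation.subrepresentationSubmoduleOrderIso (ρ := R)) with he
  have hW : IsAtom (e.symm N) := (e.symm.isAtom_iff N).mpr hN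
  obtain ⟨h, hreg, -⟩ := hH.exists_isRegularSemisimple (e.symm N) hW
  exact ⟨h, h.2, hreg⟩

end Enormous

/-! ## §3. Decomposed generic from one regular semisimple element of `τ(Γ_{ℚ(ζ_p)})` (Chebotarev) -/

section DecomposedGeneric

variable {p : ℕ} [Fact p.Prime] {k : Type w} [Field k] {n : ℕ}

/-- The eigenvalues (with multiplicity, in `k̄`) of a regular semisimple `g ∈ GL_n(k)` are pairwise
distinct: its characteristic polynomial is separable. [folklore] -/
theorem nodup_eigenvalueMultiset_of_isRegularSemisimple {g : GL (Fin n) k}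
    (hg : IsRegularSemisimple g) : (eigenvalueMultiset g).Nodup := by
  rw [eigenvalueMultiset_def]
  exact Polynomial.nodup_roots (Polynomial.Separable.map hg)

/-- Every rational prime `l` splits completely in `ℚ` (`e = f = 1`): `ℚ/ℚ` is unramified at `l`
(`discr ℚ = 1`, Mathlib `NumberField.not_dvd_discr_iff_isUnramifiedIn`) and the place of `ℚ` above
`l` has residue field of cardinality `l`. [folklore] -/
theorem Rat.splitsCompletely {l : ℕ} (hl : l.Prime) : SplitsCompletely ℚ l := by
  refine ⟨?_, fun v hv => ?_⟩
  · have hdisc : ¬ (l : ℤ) ∣ NumberField.discr ℚ := by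
      rw [NumberField.discr_rat]
      exact fun h => hl.one_lt.ne' (by exact_mod_cast Int.eq_one_of_dvd_one (Int.natCast_nonneg l) h)
    exact (NumberField.not_dvd_discr_iff_isUnramifiedIn ℚ (𝓞 ℚ)
      (Nat.prime_iff_prime_int.mp hl)).mp hdisc
  · rw [Rat.residueCard_eq_natGenerator v, Rat.natGenerator_eq_of_natCast_mem hl hv]

/-- **Decomposed generic from one regular semisimple element of `τ(Γ_{ℚ(ζ_p)})`** (the Chebotarev
argument of ACC+ Lemma 4.3.2 / Lemma 7.1.3 (3), over `ℚ`).  Let `k` have characteristic `p` and let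
`τ : Γ_ℚ → GL_n(k)` have open kernel (e.g. a residual representation).  If some `g ∈ Γ_{ℚ(ζ_p)}`
has `τ g` regular semisimple, then `τ` is decomposed generic (ACC+ Def. 4.3.1): Chebotarev
(`infinite_setOf_prime_absNorm_frobenius_mul_inv_mem`, for the open normal subgroup
`N = ker τ ∩ Γ_{ℚ(ζ_p)}` and the coset `N g`) gives a prime `l ≠ p` with `τ(I_𝔓) = 1` for all
`𝔓 ∣ l` and a Frobenius `Φ ∈ N g`; then `Φ ∈ Γ_{ℚ(ζ_p)}`, so `l ≡ 1 (mod p)`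
(`residueCard_modEq_one_of_isArithFrobAt_of_mem`), i.e. `l = 1` in `k̄`; every Frobenius above `l`
is `τ`-conjugate to `τ Φ = τ g` (transitivity of `Γ_ℚ` on the primes above `l`, inertia killed),
so its eigenvalues are pairwise distinct with ratios `≠ 1 = l`; and `l` splits completely in `ℚ`.
[cite: ACCGHLNSTT2023, Def. 4.3.1 and Lemma 4.3.2] -/
theorem isDecomposedGeneric_of_exists_isRegularSemisimple [CharP k p]
    (τ : absoluteGaloisGroup ℚ →* GL (Fin n) k) (hker : IsOpen (τ.ker : Set (absoluteGaloisGroup ℚ)))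
    (hreg : ∃ g ∈ absGaloisGroupAdjoinRootsOfUnity ℚ p, IsRegularSemisimple (τ g)) :
    IsDecomposedGeneric τ := by
  classical
  have hp : p.Prime := Fact.out
  obtain ⟨g, hg₁, hgreg⟩ := hreg
  set Γ₁ : Subgroup (absoluteGaloisGroup ℚ) := absGaloisGroupAdjoinRootsOfUnity ℚ p with hΓ₁
  haveI hΓ₁n : Γ₁.Normal := normal_absGaloisGroupAdjoinRootsOfUnity ℚ p
  set N : Subgroup (absoluteGaloisGroup ℚ) := τ.ker ⊓ Γ₁ with hNdef
  haveI : N.Normal := Subgroup.normal_inf_normal τ.ker Γ₁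
  have hN : IsOpen (N : Set (absoluteGaloisGroup ℚ)) := by
    rw [hNdef, Subgroup.coe_inf]
    exact hker.inter (isOpen_absGaloisGroupAdjoinRootsOfUnity ℚ p hp.pos)
  have hNker : ∀ x ∈ N, τ x = 1 := fun x hx => (MonoidHom.mem_ker).mp hx.1
  have hNΓ₁ : N ≤ Γ₁ := fun x hx => hx.2
  -- Chebotarev for the coset `N g`, away from the place above `p`
  have hC := infinite_setOf_prime_absNorm_frobenius_mul_inv_mem N hN g
  obtain ⟨v, ⟨-, hinertia, 𝔓, h𝔓, Φ, hΦ, hΦg⟩, hpv⟩ :=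
    (hC.sdiff (Rat.finite_setOf_natCast_mem hp)).nonempty
  simp only [Set.mem_setOf_eq] at hpv
  -- the rational prime `l` below `v`
  set l : ℕ := natGenerator v with hl
  have hlprime : l.Prime := prime_natGenerator v
  have hlv : (l : 𝓞 ℚ) ∈ v.asIdeal := (Rat.natCast_mem_asIdeal_iff v).2 dvd_rfl
  have hlp : l ≠ p := fun h => hpv (h ▸ hlv)
  have hql : v.residueCard = l := Rat.residueCard_eq_natGenerator v
  -- `τ Φ = τ g` and `Φ ∈ Γ_{ℚ(ζ_p)}`
  have hτΦ : τ Φ = τ g := by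
    have h1 : τ (Φ * g⁻¹) = 1 := hNker _ hΦg
    rwa [map_mul, map_inv, mul_inv_eq_one] at h1
  have hΦ1 : Φ ∈ Γ₁ := by
    have : Φ = Φ * g⁻¹ * g := by group
    rw [this]
    exact Γ₁.mul_mem (hNΓ₁ hΦg) hg₁
  -- `l ≡ 1 (mod p)`, so `l = 1` in `k̄`
  have hl1 : l ≡ 1 [MOD p] := by
    have := residueCard_modEq_one_of_isArithFrobAt_of_mem hp hpv h𝔓 hΦ hΦ1
    rwa [hql] at this
  have hlcast : ((l : ℕ) : AlgebraicClosure k) = 1 := by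
    have h1 : ((l : ℕ) : k) = 1 := by
      rw [CharP.natCast_eq_natCast' k p hl1, Nat.cast_one]
    rw [← map_natCast (algebraMap k (AlgebraicClosure k)) l, h1, map_one]
  -- every place of `ℚ` containing `l` is `v`
  have hwv : ∀ w : HeightOneSpectrum (𝓞 ℚ), ((l : ℕ) : 𝓞 ℚ) ∈ w.asIdeal → w = v := fun w hw =>
    Rat.natGenerator_injective ((Rat.natGenerator_eq_of_natCast_mem hlprime hw).trans hl.symm)
  refine ⟨l, hlprime, ?_, Rat.splitsCompletely hlprime, fun w hw => ?_⟩
  · rw [ringChar.eq k p]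
    exact hlp
  obtain rfl := hwv w hw
  refine ⟨fun 𝔔 h𝔔 x hx => hNker x (hinertia 𝔔 h𝔔 hx), fun 𝔔 h𝔔 φ hφ => ?_⟩
  -- a Frobenius `φ` at `𝔔 ∣ l` is `τ`-conjugate to `τ g`
  obtain ⟨γ, hγ⟩ := HeightOneSpectrum.exists_smul_eq_of_mem_primesAbove_holds h𝔓 h𝔔
  have hΦ' : IsArithFrobAt (𝓞 ℚ) (γ * Φ * γ⁻¹) 𝔔 := hγ ▸ hΦ.conj γ
  have hin : φ * (γ * Φ * γ⁻¹)⁻¹ ∈ 𝔔.inertia (absoluteGaloisGroup ℚ) := hφ.mul_inv_mem_inertia hΦ'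
  have hτφ : τ φ = τ γ * τ g * (τ γ)⁻¹ := by
    have h1 : τ (φ * (γ * Φ * γ⁻¹)⁻¹) = 1 := hNker _ (hinertia 𝔔 h𝔔 hin)
    rw [map_mul, map_inv, mul_inv_eq_one] at h1
    rw [h1, map_mul, map_mul, map_inv, hτΦ]
  rw [hτφ, CaraianiNewton.eigenvalueMultiset_conj, hql]
  exact ⟨nodup_eigenvalueMultiset_of_isRegularSemisimple hgreg,
    CaraianiNewton.ne_mul_of_cast_eq_one hlcast _⟩

end DecomposedGeneric


/-! ## §4. The registered sub-goal: decomposed generic for residual representations over `ℤ̄_p/𝔪` -/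

section Residual

/-- **Decomposed generic for a residual representation of `ρ : Γ_ℚ → GL_n(ℚ̄_p)` from one regular
semisimple `τ g`, `g ∈ Γ_{ℚ(ζ_p)}`** (closed form, the sub-goal registered on the crux item): the
kernel of a residual representation is open (`isOpen_ker_of_isResidualRepOf`) and
`char (ℤ̄_p/𝔪) = p` (`charP_padicAlgClResidueField`), so
`isDecomposedGeneric_of_exists_isRegularSemisimple` applies.
[cite: ACCGHLNSTT2023, Def. 4.3.1 and Lemma 4.3.2] -/
theorem adjointResidualImage_decomposedGeneric :
    ∀ (p : ℕ) [Fact p.Prime] (n : ℕ) (ρ : FramedGaloisRep ℚ (PadicAlgCl p) n)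
      (τ : absoluteGaloisGroup ℚ →* GL (Fin n) (padicAlgClResidueField p)),
      ρ.IsResidualRepOf (RingHom.id _) τ →
        (∃ g ∈ absGaloisGroupAdjoinRootsOfUnity ℚ p, IsRegularSemisimple (τ g)) →
          IsDecomposedGeneric τ := by
  intro p _ n ρ τ hτ hreg
  haveI := charP_padicAlgClResidueField p
  exact isDecomposedGeneric_of_exists_isRegularSemisimple (p := p) τ
    (FramedGaloisRep.isOpen_ker_of_isResidualRepOf hτ) hreg

end Residual

end Summit.Langlands.Langlands.Cruxes.AdjointLiftingGL3.Birth

end
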